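import Literature.AnabelianGeometry.EtaleTheta.FreeMonoidPerfectionRigidity

/-!
# Divisibility-disjointness `DvdDisjoint` ([EtTh] Prop. 3.2 (i) vocabulary): closure refuted, instance forms

Mochizuki, *The étale theta function and its Frobenioid-theoretic manifestations*, Publ. RIMS **45**
(2009), Prop. 3.2 (i), PRIMS p.296 (PDF p.70) [cite: MochizukiEtTh2009, Prop 3.2 (i) p.70]: the
monoid of effective divisors and its perfection "a direct product of copies of `ℚ_{≥0}`"; two effective
divisors are *disjoint* when they have no common component.

PROOF-ONLY companion (no `def`, no instance, no named fact) of abc-iut-L2-t6's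
`FreeMonoidPerfectionRigidity.lean`, which declares the RELATION
`DvdDisjoint (a b : M) : Prop := ∀ c, c ∣ a → c ∣ b → c = 1` ("disjoint for divisibility") and uses it
in the isomorphism invariant `HasDisjointSups`.  abc-iut cell, block F (fact-proving wave), seat
abc-iut-f-118, FROZEN FACT-LIST row **F-0524** (`DvdDisjoint`, kernel_closedness = nodecl: a 2-ary
predicate with free arguments — plan R6 "vocabulary", R5 "a universal closure of a schema row is not
a fact").  What is PROVED here (kernel statements about OUR typed relation):

* `not_forall_dvdDisjoint` — the UNIVERSAL CLOSURE `∀ M a b, DvdDisjoint a b` is FALSE (instance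
  counterexample: `M = ℤ_{≥0}` written multiplicatively, `a = b = 1 ∈ ℤ_{≥0}`, common divisor `1 ≠ 0`);
  so the row is an assumption about NAMED arguments only, never a closed fact;
* the instance forms in which the relation is actually used: symmetry (`DvdDisjoint.symm`,
  `dvdDisjoint_comm`), transport under `≃*` (`dvdDisjoint_map_iff`, the step inlined in the trunk's
  `HasDisjointSups.of_mulEquiv`), `DvdDisjoint 1 b` / `DvdDisjoint a 1` in monoids with trivial unit
  group (`dvdDisjoint_one_left/right`; e.g. `∏ ℤ_{≥0}`, `∏ ℚ_{≥0}`, `boundedDenom I`), self-disjointness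
  forces `a = 1` (`eq_one_of_dvdDisjoint_self`), and the two POINTWISE CHARACTERISATIONS the trunk
  file's proofs run on: in `∏_J ℚ_{≥0}` disjoint ⟺ disjoint supports (`dvdDisjoint_pi_nnrat_iff`, the
  converse of the trunk's `eq_zero_or_eq_zero_of_dvdDisjoint`) and in `ℤ_{≥0}` disjoint ⟺ one of the
  two is `0` (`dvdDisjoint_nat_iff`).

Classical monoid algebra; nothing here bears on, or takes a side on, [IUTchIII] Cor. 3.12; a FACT row
is an assumption label, not an endorsement; typed ≠ proved.
-/

namespace Literature.AnabelianGeometry.EtaleTheta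

open Multiplicative

universe u v

/-! ### General commutative monoids -/

section General

variable {M : Type u} {N : Type v} [CommMonoid M] [CommMonoid N]

/-- Divisibility-disjointness is symmetric. (F-0524 instance form.)
[cite: MochizukiEtTh2009, Prop 3.2 (i) p.70] -/
theorem DvdDisjoint.symm {a b : M} (h : DvdDisjoint a b) : DvdDisjoint b a :=
  fun c hcb hca => h c hca hcb

/-- Divisibility-disjointness is symmetric (iff form). (F-0524 instance form.)
[cite: MochizukiEtTh2009, Prop 3.2 (i) p.70] -/
theorem dvdDisjoint_comm {a b : M} : DvdDisjoint a b ↔ DvdDisjoint b a :=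
  ⟨DvdDisjoint.symm, DvdDisjoint.symm⟩

/-- Self-disjointness of `a` says exactly that every divisor of `a` is `1`. (F-0524 instance form.)
[cite: MochizukiEtTh2009, Prop 3.2 (i) p.70] -/
theorem dvdDisjoint_self_iff (a : M) : DvdDisjoint a a ↔ ∀ c : M, c ∣ a → c = 1 :=
  ⟨fun h c hc => h c hc hc, fun h c hc _ => h c hc⟩

/-- A self-disjoint element is `1` (it divides itself). (F-0524 instance form.)
[cite: MochizukiEtTh2009, Prop 3.2 (i) p.70] -/
theorem eq_one_of_dvdDisjoint_self {a : M} (h : DvdDisjoint a a) : a = 1 :=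
  h a dvd_rfl dvd_rfl

/-- In a monoid with trivial unit group (e.g. `∏ ℤ_{≥0}`, `∏ ℚ_{≥0}`, their submonoids), `1` is
disjoint from everything: a divisor of `1` is a unit, hence `1`. (F-0524 instance form.)
[cite: MochizukiEtTh2009, Prop 3.2 (i) p.70] -/
theorem dvdDisjoint_one_left [Subsingleton Mˣ] (b : M) : DvdDisjoint (1 : M) b :=
  fun _ hc _ => isUnit_iff_eq_one.mp (isUnit_of_dvd_one hc)

/-- In a monoid with trivial unit group, everything is disjoint from `1`. (F-0524 instance form.)
[cite: MochizukiEtTh2009, Prop 3.2 (i) p.70] -/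
theorem dvdDisjoint_one_right [Subsingleton Mˣ] (a : M) : DvdDisjoint a (1 : M) :=
  (dvdDisjoint_one_left a).symm

/-- Divisibility-disjointness is transported by isomorphisms of monoids (the step inlined in the
trunk file's `HasDisjointSups.of_mulEquiv`). (F-0524 instance form.)
[cite: MochizukiEtTh2009, Prop 3.2 (i) p.70] -/
theorem dvdDisjoint_map_iff (e : M ≃* N) {a b : M} : DvdDisjoint (e a) (e b) ↔ DvdDisjoint a b := by
  constructor
  · intro h c hca hcb
    have h1 : e c = 1 := h (e c) (map_dvd e hca) (map_dvd e hcb)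
    simpa using congrArg e.symm h1
  · intro h c hca hcb
    have h1 : e.symm c ∣ a := by simpa using map_dvd e.symm hca
    have h2 : e.symm c ∣ b := by simpa using map_dvd e.symm hcb
    have h3 : e.symm c = 1 := h (e.symm c) h1 h2
    simpa using congrArg e h3

end General

/-! ### `ℤ_{≥0}` written multiplicatively -/

section Nat

/-- Divisibility in `ℤ_{≥0}` (written multiplicatively) is the order. (F-0524 instance form.)
[cite: MochizukiEtTh2009, Prop 3.2 (i) p.70] -/
theorem nat_dvd_iff {a b : Multiplicative ℕ} : a ∣ b ↔ toAdd a ≤ toAdd b := by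
  constructor
  · rintro ⟨c, rfl⟩
    rw [toAdd_mul]
    exact Nat.le_add_right _ _
  · intro h
    refine ⟨ofAdd (toAdd b - toAdd a), toAdd.injective ?_⟩
    rw [toAdd_mul, toAdd_ofAdd, Nat.add_sub_cancel' h]

/-- In `ℤ_{≥0}` two effective divisors are disjoint iff one of them is `0`. (F-0524 instance form.)
[cite: MochizukiEtTh2009, Prop 3.2 (i) p.70] -/
theorem dvdDisjoint_nat_iff {a b : Multiplicative ℕ} :
    DvdDisjoint a b ↔ toAdd a = 0 ∨ toAdd b = 0 := by
  constructor
  · intro h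
    by_contra hne
    push Not at hne
    have h1 : ofAdd 1 ∣ a := nat_dvd_iff.mpr (Nat.one_le_iff_ne_zero.mpr hne.1)
    have h2 : ofAdd 1 ∣ b := nat_dvd_iff.mpr (Nat.one_le_iff_ne_zero.mpr hne.2)
    exact absurd (congrArg toAdd (h _ h1 h2)) (by simp)
  · rintro (h0 | h0) c hca hcb
    · have hc : toAdd c ≤ 0 := h0 ▸ nat_dvd_iff.mp hca
      exact toAdd.injective (Nat.le_zero.mp hc)
    · have hc : toAdd c ≤ 0 := h0 ▸ nat_dvd_iff.mp hcb
      exact toAdd.injective (Nat.le_zero.mp hc)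

/-- **The universal closure of the FACT-LIST row F-0524 (`DvdDisjoint`) is FALSE**: in `ℤ_{≥0}` the
divisor `1` is not disjoint from itself (`1` is a common divisor `≠ 0`).  `DvdDisjoint` is a RELATION
on named arguments (plan R6), never a closed fact (R5).
[cite: MochizukiEtTh2009, Prop 3.2 (i) p.70] -/
theorem not_forall_dvdDisjoint : ¬ ∀ (M : Type) [CommMonoid M] (a b : M), DvdDisjoint a b := by
  intro h
  have h1 : (ofAdd 1 : Multiplicative ℕ) = 1 := eq_one_of_dvdDisjoint_self (h _ _ _)
  exact absurd (congrArg toAdd h1) (by simp)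

/-- Pointed form of `not_forall_dvdDisjoint`: the explicit failing instance.
[cite: MochizukiEtTh2009, Prop 3.2 (i) p.70] -/
theorem not_dvdDisjoint_ofAdd_one : ¬ DvdDisjoint (ofAdd 1 : Multiplicative ℕ) (ofAdd 1) := by
  rw [dvdDisjoint_nat_iff]
  simp

end Nat

/-! ### The full product `∏_J ℚ_{≥0}` -/

section Pi

variable {J : Type u}

/-- **In `∏_J ℚ_{≥0}` two elements are divisibility-disjoint iff their supports are disjoint** (the
pointwise characterisation; `→` is the trunk file's `eq_zero_or_eq_zero_of_dvdDisjoint`, `←`: a common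
divisor is pointwise below both, hence `0` at every index). (F-0524 instance form.)
[cite: MochizukiEtTh2009, Prop 3.2 (i) p.70] -/
theorem dvdDisjoint_pi_nnrat_iff {f g : J → Multiplicative ℚ≥0} :
    DvdDisjoint f g ↔ ∀ j, toAdd (f j) = 0 ∨ toAdd (g j) = 0 := by
  refine ⟨fun h j => eq_zero_or_eq_zero_of_dvdDisjoint h j, fun h c hcf hcg => ?_⟩
  funext j
  apply toAdd.injective
  rw [Pi.one_apply, toAdd_one]
  have h1 := (pi_nnrat_dvd_iff.mp hcf) j
  have h2 := (pi_nnrat_dvd_iff.mp hcg) j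
  rcases h j with h0 | h0
  · rw [h0] at h1
    exact le_antisymm h1 zero_le
  · rw [h0] at h2
    exact le_antisymm h2 zero_le

/-- Distinct coordinate vectors `e_i ≠ e_j` of `∏_J ℚ_{≥0}` (any nonnegative weights) are disjoint —
the shape of the family used in the trunk file's `not_hasDisjointSups_boundedDenom`. (F-0524 instance form.)
[cite: MochizukiEtTh2009, Prop 3.2 (i) p.70] -/
theorem dvdDisjoint_mulSingle [DecidableEq J] {i j : J} (hij : i ≠ j) (p q : ℚ≥0) :
    DvdDisjoint (Pi.mulSingle i (ofAdd p) : J → Multiplicative ℚ≥0) (Pi.mulSingle j (ofAdd q)) := by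
  rw [dvdDisjoint_pi_nnrat_iff]
  intro k
  by_cases hk : k = i
  · subst hk
    right
    simp [Pi.mulSingle_eq_of_ne hij]
  · left
    simp [Pi.mulSingle_eq_of_ne hk]

end Pi

end Literature.AnabelianGeometry.EtaleTheta
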